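import Literature.IUT.HodgeArakelov.ThetaEnvDataRecordBridge

/-!
# [IUTchII] Cor 3.5 (ii)/(iii): the junction hypothesis `horb` ("`θ^ι_env(M^Θ_*)` is ONE `M^×_TM`-orbit") at the
# PRODUCED record `ThetaEnvData.toRecord` — from Prop 2.2 (ii)′ "`θ^ι(Π_v)` is a `μ_{2l}`-orbit" and `M^μ_TM ⊆ M^×_TM`
# (proof-only companion to abc-iut-w4-d019's `ThetaEnvDataRecordBridge.lean`)

S. Mochizuki, *Inter-universal Teichmüller theory II*, kurims Dec-2020 manuscript: Prop 2.2 (ii) p. 66 / Cor 2.8 (i)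
p. 82 ("`μ_{2l}`-orbits of elements `θ^t_env`"), Cor 1.12 p. 57 (`M^μ_TM ⊆ M^×_TM`), Prop 3.1 (i) p. 87
("`Ψ^ι_env := M^×_TM · θ^ι_env^ℕ`"), Cor 3.5 (ii) p. 95 [cite: Mochizuki2012, Cor 3.5 (ii) p.95]. Claim key DISPUTED
(D-0012). PROOF-ONLY companion (abc-iut cell, layer L6, seat abc-iut-w4-d004 gen 2; node **IUTchII:Cor3.5(ii)**,
restriction-iso clause; sub-DAG rows Cor-35.ii.r12 / P31.i.r2 (J1)). NO definition, NO `Prop` fact.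

The restriction ISOMORPHISM of record `Ψ^ι_env ⥲ Ψ_ξ` (abc-iut-w4-d004
`BadPrimeGaussianMonoidsProofs4.exists_unique_restrictionIso'_thetaMonoid`) and the identification
`Ψ^ι_env = M^×_TM · θ^ℕ` (`thetaMonoid_eq_splitMonoid_powers`) carry the junction hypothesis
`horb : ∀ θ' ∈ θ^ι_env, ∃ u ∈ M^×_TM, θ' = u · θ`. For the record PRODUCED by abc-iut-w4-d019's bridge
`T.toRecord act κ iota` (`θ^ι_env :=` transport along the cyclotomic rigidity isomorphism of the `ι`-invariants up to
torsion of `toLim ⊤ '' θ(Π)`), with the inversion of label `i₀` taken from abc-iut-L6-t19's Prop 2.2 (ii)′ datum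
`Θ : IotaInvariantTheta'` (`iota i₀ = Θ.iotaLim`), THIS FILE derives `horb` from:
* `Θ.thetaIota_orbit` — "`θ^ι(Π_v)` is a `μ_{2l}`-orbit: any two `ι`-invariants up to torsion differ by a `2l`-torsion
  class" (the typed Prop 2.2 (ii)′ field), read in the limit through abc-iut-w4-d019's `toLim_image_thetaIota_eq`
  under its hypothesis `hker` ("`Ker(H¹(Π_Ÿ) → lim_J)` is torsion" — TRUE at the model: `toLim ⊤` is injective,
  abc-iut-w5-d187 `IotaInvariantThetaInftyModel`);
* `htors` — `M^μ_TM ⊆ M^×_TM` (torsion classes are units; the `hμ` binder of the Cor 1.12 files).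
Results: `exists_torsion_mul_of_mem_toRecord_thetaEnv` (any two elements of `θ^{i₀}_env` of the record differ by a
`2l`-torsion element), `horb_toRecord` (the hypothesis `horb` HOLDS for the record).

Nothing here asserts a disputed claim or takes a side on [IUTchIII] Cor 3.12; typed ≠ proved ≠ endorsed.
-/

namespace Literature.IUT.HodgeArakelov

namespace BadPrimeGaussianMonoids

universe u

variable {S' : BadPlaceSetting.{u}} {F' : ModelFamily S'.toThetaSetting} {Sys' : MonoThetaProjSystem F'}
  (T' : ThetaEnvData Sys') {Tc : TemperedCoverings S' Sys'.PiX} {Dec : SubgraphDecomposition S' Tc T'.D}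
  (Θ : IotaInvariantTheta' Dec) (act : Sys'.PiX →* MulAut (Multiplicative T'.cohEnv.lim)) {M : Type u}
  [CommMonoid M] (κ : M →* Multiplicative T'.cohEnv.lim) {Iota : Type u}
  (iota : Iota → (T'.D.coh.lim ≃+ T'.D.coh.lim))

/-- Every element of `θ^{i₀}_env` of the produced record is the transport of a class of `θ^ι(Π_v)` (Prop 2.2 (ii)′,
`IotaInvariantTheta'.thetaIota`), when the inversion of label `i₀` is `Θ.iotaLim` and `Ker(H¹(Π_Ÿ) → lim)` is torsion.
[cite: Mochizuki2012, Prop 2.2 (ii) p.66] -/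
theorem exists_thetaIota_of_mem_toRecord_thetaEnv
    (hker : ∀ y : T'.D.coh.H1 ⊤, T'.D.coh.toLim ⊤ y = 0 → IsOfFinAddOrder y) {i₀ : Iota}
    (hi₀ : iota i₀ = Θ.iotaLim) {η : Multiplicative T'.cohEnv.lim}
    (hη : η ∈ (T'.toRecord act κ iota).thetaEnv i₀) :
    ∃ t ∈ Θ.thetaIota, Multiplicative.toAdd η = T'.transportLim (T'.D.coh.toLim ⊤ t) := by
  have h1 := (ThetaEnvData.mem_envSet_iff T' (T'.thetaIotaLim (iota i₀)) η).mp hη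
  rw [hi₀, ← ThetaEnvData.toLim_image_thetaIota_eq T' Θ hker] at h1
  obtain ⟨t, ht, hteq⟩ := h1
  exact ⟨t, ht, by rw [hteq, AddEquiv.apply_symm_apply]⟩

/-- **Any two elements of `θ^{i₀}_env(M^Θ_*)` of the produced record differ by a `2l`-torsion element** — the
`μ_{2l}`-orbit clause of Prop 2.2 (ii)′ / Cor 2.8 (i) (`Θ.thetaIota_orbit`) transported along the cyclotomic rigidity
isomorphism. [cite: Mochizuki2012, Cor 2.8 (i) p.82] -/
theorem exists_torsion_mul_of_mem_toRecord_thetaEnv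
    (hker : ∀ y : T'.D.coh.H1 ⊤, T'.D.coh.toLim ⊤ y = 0 → IsOfFinAddOrder y) {i₀ : Iota}
    (hi₀ : iota i₀ = Θ.iotaLim) {θ θ' : Multiplicative T'.cohEnv.lim}
    (hθ : θ ∈ (T'.toRecord act κ iota).thetaEnv i₀) (hθ' : θ' ∈ (T'.toRecord act κ iota).thetaEnv i₀) :
    ∃ τ : Multiplicative T'.cohEnv.lim, τ ^ (2 * S'.l) = 1 ∧ θ' = τ * θ := by
  obtain ⟨t, ht, hte⟩ := exists_thetaIota_of_mem_toRecord_thetaEnv T' Θ act κ iota hker hi₀ hθ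
  obtain ⟨t', ht', hte'⟩ := exists_thetaIota_of_mem_toRecord_thetaEnv T' Θ act κ iota hker hi₀ hθ'
  have horb : (2 * S'.l) • (t' - t) = 0 := Θ.thetaIota_orbit t ht.1 t' ht'.1 ht.2 ht'.2
  refine ⟨Multiplicative.ofAdd (T'.transportLim (T'.D.coh.toLim ⊤ (t' - t))), ?_, ?_⟩
  · rw [← ofAdd_nsmul, ← map_nsmul, ← map_nsmul, horb, map_zero, map_zero, ofAdd_zero]
  · apply Multiplicative.toAdd.injective
    rw [toAdd_mul, toAdd_ofAdd, hte, hte', ← map_add, ← map_add, sub_add_cancel]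

/-- **IUTchII:Cor3.5(ii)** junction hypothesis `horb` HOLDS for the produced record: `θ^{i₀}_env(M^Θ_*)` is a single
`M^×_TM`-orbit, given `M^μ_TM ⊆ M^×_TM` (`htors`: torsion classes are units — Cor 1.12 p. 57) and
`Ker(H¹(Π_Ÿ) → lim)` torsion (`hker`). This is the `horb` binder of
`BadPrimeGaussianMonoidsProofs4.exists_unique_restrictionIso'_thetaMonoid` / `thetaMonoid_eq_splitMonoid_powers`.
[cite: Mochizuki2012, Cor 3.5 (ii) p.95] -/
theorem horb_toRecord
    (hker : ∀ y : T'.D.coh.H1 ⊤, T'.D.coh.toLim ⊤ y = 0 → IsOfFinAddOrder y) {i₀ : Iota}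
    (hi₀ : iota i₀ = Θ.iotaLim)
    (htors : ∀ u : (T'.toRecord act κ iota).H, IsOfFinOrder u → u ∈ (T'.toRecord act κ iota).units)
    {θ : (T'.toRecord act κ iota).H} (hθ : θ ∈ (T'.toRecord act κ iota).thetaEnv i₀) :
    ∀ θ' ∈ (T'.toRecord act κ iota).thetaEnv i₀, ∃ u ∈ (T'.toRecord act κ iota).units, θ' = u * θ := by
  intro θ' hθ'
  obtain ⟨τ, hτ, h⟩ := exists_torsion_mul_of_mem_toRecord_thetaEnv T' Θ act κ iota hker hi₀ hθ hθ'
  exact ⟨τ, htors τ (isOfFinOrder_iff_pow_eq_one.mpr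
    ⟨2 * S'.l, Nat.mul_pos two_pos S'.l_prime.pos, hτ⟩), h⟩

end BadPrimeGaussianMonoids

end Literature.IUT.HodgeArakelov
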